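import Literature.IUT.LogThetaLattice.LatticeDiagramOfKitsTaggedToy
import Literature.IUT.LogThetaLattice.LatticeGlueOfKitsToy

/-!
# Non-vacuity: the glued [IUTchIII] §1–§2 input `LatticeGlue.ofKits` TOGETHER WITH its log-theta-lattice (Def 1.4) over TAGGED toy kits

Mochizuki, *Inter-universal Teichmüller Theory III*, kurims manuscript (May 2020), §1–§2 (Def 1.1, Prop 1.2 (vi)–(ix), Def 1.4 p. 45,
Thm 1.5 (iii)–(v) pp. 48–51, Prop 2.1, Thm 2.2 (i), Cor 2.3 p. 72); *II* (Dec 2020), Def 4.9 (vi)–(viii) p. 158, Cor 4.5 (ii) p. 132,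
Cor 4.10 (i)–(v) pp. 158–161; *I* (May 2020) Def 4.1 (iii)(iv) p. 96. ([IUTchIII] Cor 2.3 (i) p.72) [claim: Mochizuki2012, status: disputed].
abc-iut cell, seat abc-iut-w5-d043 (L6 NV register, row «NV-W2 IUTchIII:Def1.4», sequel to `LatticeDiagramOfKitsTaggedToy.lean`).

abc-iut-L6-t3's toy witness `KitsToy.latticeGlue` (`LatticeGlueOfKitsToy.lean`) inhabits `LatticeGlue.ofKits` over abc-iut-L5-t4's
toy kits, but its companion `KitsToy.latticeDiagram (kind) (H) (hH)` keeps the INJECTIVE family of Hodge theaters demanded by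
Def 1.4 as a PARAMETER — uninstantiable over the toy kit (finitely many provably distinct theaters). Over the TAGGED toy kit
`FKit.toyTagged` (ambient categories `InducedCategory (Model.Obj l) Prod.snd` on `(ℤ × ℤ) × Model.Obj l`; base kit `toyKit`, `MultKit.toy`
unchanged) this file re-runs the whole kit stack in the byte-shapes of abc-iut-w4-d005's `BiCoresOfKitsToy.lean` and abc-iut-L6-t3's
`LatticeGlueOfKitsToy.lean` — `biCoricKit` (with the GENUINELY shaped [IUTchII] Cor 4.5 (ii) slot `realifiedDSmall`, reusing
abc-iut-w4-d005's `KitsToy.toyLines/toyCoeff`), `thetaMonoidKit`, `thetaCoricKit`, `latticeGlueKit`, **`latticeGlue : LatticeGlue (KitsTaggedToy.frame l hl)`**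
— and then instantiates the lattice with NO parameter left: **`glueLatticeDiagram kind : LogThetaLatticeDiagram latticeGlue.logData
latticeGlue.linkData`** over the injective family `KitsTaggedToy.thetaPMEllHT` (the pair `(latticeGlue, glueLatticeDiagram)` is the input
shape of the Cor 3.12 crew's `Thm311LinkGlue.ofGlue`, at universe `1`). Also Thm 1.5 (v) / `RealifiedRigidAt` at the tagged frame
(abc-iut-w4-d009's real-frame theorems, no hypothesis left). HONEST LABEL (abc-iut-L6-lead §F v1.19j (1)): tagged copies of ONE
toy model realise print's "distinct copies indexed by pairs of integers" (Def 1.4 p.45); nothing here bears on the real-kit line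
(abc-iut-L5-t4). TOY kit stack with tags — a consistency / non-vacuity witness for the kit-level interfaces, NOT genuine Hodge
theaters; consistency ≠ endorsement; no side taken on [IUTchIII] Cor 3.12.
-/

noncomputable section

namespace Literature.IUT.LogThetaLattice

open CategoryTheory
open Literature.IUT.HodgeTheaters Literature.IUT.HodgeTheaters.PMBaseKit Literature.IUT.HodgeArakelov
open Literature.AnabelianGeometry.AbsoluteAnabelian
open AsSmallTransport

namespace KitsTaggedToy

variable (l : ℕ) [Fact l.Prime] (hl : l ≠ 2)

/-! ### 1. The tagged toy `BiCoricKit` (shape of abc-iut-w4-d005's `KitsToy.biCoricKit`) -/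

/-- **IUTchII:Rmk4.5.1(i)** (kurims p.133) Over the tagged toy kit: `F(*𝔇)` := the tag-`(0,0)` copy of `*𝔇` (the `ℱ`-prime-strip whose
constituents are those of `*𝔇`, tagged `(0,0)`), functorially (tag the isomorphisms). [claim: Mochizuki2012, status: disputed] -/
def fOfD : (toyKit l hl).DStrip ⥤ (FKit.toyTagged l hl).FStrip where
  obj D := ⟨fun v => (((0 : ℤ), (0 : ℤ)), D.obj v), fun v => ⟨InducedCategory.isoMk (D.isLocal v).some⟩⟩
  map φ := fun v => InducedCategory.isoMk (φ v)
  map_id _ := rfl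
  map_comp _ _ := rfl

/-- **IUTchII:Rmk4.5.1(i)** (kurims p.133) … whose associated `𝒟`-prime-strip is `*𝔇` again (forget the tag). [claim: Mochizuki2012, status: disputed] -/
def fOfD_D : fOfD l hl ⋙ PrimeStripGroupoids.assocDFunctor (FKit.toyTagged l hl) ≅ 𝟭 _ :=
  Iso.refl _

/-- **IUTchIII:Thm1.5(iii)** (kurims p.48) with **IUTchIII:Prop1.2(vi)–(ix)** (pp. 32–34): the TAGGED toy kit-level bi-coric datum — shells
and Frobenius-like strips on the one-object groupoid with FULL orbit data, `F(*𝔇)` = `fOfD`, `F^{⊢×μ}_△(−) := 𝟭`, and the [IUTchII]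
Cor 4.5 (ii) slot in the GENUINE torsor shape (`RlfImage` / `realifiedDSmall` on abc-iut-w4-d005's `KitsToy.toyLines/toyCoeff`).
[claim: Mochizuki2012, status: disputed] -/
def biCoricKit : BiCoricKit (timesMuSide l hl) where
  Sh := (MultKit.toy l hl).DMono
  holShell := (Functor.const _).obj (SingleObj.star Unit)
  fxmShell := (Functor.const _).obj (SingleObj.star Unit)
  monoShell := (Functor.const _).obj (SingleObj.star Unit)
  monoFxm _ := PolyIso.full _ _
  monoFxm_nonempty _ := ⟨Iso.refl _, PolyIso.mem_full _⟩
  monoFxm_map _ _ _ := PolyIso.mem_full _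
  monoFxmOfF _ := PolyIso.full _ _
  monoFxmOfF_nonempty _ := ⟨Iso.refl _, PolyIso.mem_full _⟩
  monoFxmOfF_le _ := subset_rfl
  fxmHol _ := PolyIso.full _ _
  fxmHol_nonempty _ := ⟨Iso.refl _, PolyIso.mem_full _⟩
  FofD := fOfD l hl
  FofD_D := fOfD_D l hl
  fxmOfDv := 𝟭 _
  fxmOfDv_dv := Iso.refl _
  dvDelta := (Functor.const _).obj (SingleObj.star Unit)
  fxOfDsucc := (Functor.const _).obj (SingleObj.star Unit)
  fxOfDsucc_delta := NatIso.ofComponents (fun _ => Iso.refl _) (fun _ => rfl)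
  fxmDeltaHT := (Functor.const _).obj (SingleObj.star Unit)
  kummer := NatIso.ofComponents (fun _ => Iso.refl _) (fun _ => rfl)
  RFrob := RlfImage (KitsToy.toyLines l hl) (KitsToy.toyCoeff l hl) (KitsToy.toyCoeff_pos l hl)
  realified := realifiedDSmall (KitsToy.toyLines l hl) (KitsToy.toyCoeff l hl) (KitsToy.toyCoeff_pos l hl)
  realifiedHT := HTRep.toDFunctor ⋙ (Functor.const _).obj (SingleObj.star Unit) ⋙
    realifiedDSmall (KitsToy.toyLines l hl) (KitsToy.toyCoeff l hl) (KitsToy.toyCoeff_pos l hl)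
  realifiedKummer _ := PolyIso.full _ _
  realifiedKummer_nonempty _ := ⟨Iso.refl _, PolyIso.mem_full _⟩

/-- **IUTchIII:Thm1.5(iii)** (kurims p.48) the kit-level bi-coric interface IS inhabited over the tagged toy `TimesMuSide`.
[claim: Mochizuki2012, status: disputed] -/
theorem nonempty_biCoricKit :
    Nonempty (BiCoricKit (Literature.IUT.LogThetaLattice.KitsTaggedToy.timesMuSide l hl)) := ⟨biCoricKit l hl⟩

/-- **IUTchIII:Thm1.5(iii)–(v)** (kurims pp. 48–51) `BiCoricData` over the assembled tagged toy frame (abc-iut-L6-t3's `BiCoricData.ofKits`).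
[claim: Mochizuki2012, status: disputed] -/
def biCoricData : BiCoricData (frame l hl) :=
  BiCoricData.ofKits (FKit.MonoLaws.toyTagged l hl) (FKit.isomFtoDBijective_toyTagged l hl)
    (FKit.isomFmtoDmSurjective_toyTagged l hl) (FKit.rlfOfIsStrip_toyTagged l hl) (timesMuSide l hl) (biCoricKit l hl)

/-- **IUTchIII:Thm1.5(v)** (kurims p.50) «induce … AN isomorphism of collections of data» HOLDS for the tagged toy frame's bi-coric datum
(abc-iut-w4-d009's `thm15vSingleIso_ofKits_of_realifiedD` with `Φ₀ := 𝟭`, `U₀ := inducedFunctor _`, `η₀ := realifiedDSmallForgetIso`; no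
hypothesis left). [claim: Mochizuki2012, status: disputed] -/
theorem thm15vSingleIso : (biCoricData l hl).Thm15vSingleIso :=
  @thm15vSingleIso_ofKits_of_realifiedD _ _ _ _ (FKit.MonoLaws.toyTagged l hl) (FKit.isomFtoDBijective_toyTagged l hl)
    (FKit.isomFmtoDmSurjective_toyTagged l hl) (FKit.rlfOfIsStrip_toyTagged l hl) (timesMuSide l hl) (biCoricKit l hl) _ _ _
    (KitsToy.toyLines l hl) (KitsToy.toyCoeff l hl) (KitsToy.toyCoeff_pos l hl) (𝟭 _)
    (inducedFunctor (fun X : (MultKit.toy l hl).DMono =>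
      (realifiedD (KitsToy.toyLines l hl) (KitsToy.toyCoeff l hl) (KitsToy.toyCoeff_pos l hl)).obj X))
    (InducedCategory.faithful _)
    (realifiedDSmallForgetIso (KitsToy.toyLines l hl) (KitsToy.toyCoeff l hl) (KitsToy.toyCoeff_pos l hl) ≪≫
      (Functor.leftUnitor _).symm)

/-- **IUTchII:Cor4.10(v)** (kurims p.160) the consumer hypothesis `RealifiedRigidAt` (FACT-LIST F-2066) HOLDS at every pair of
`𝒟^⊢`-prime-strips of the tagged toy frame. [claim: Mochizuki2012, status: disputed] -/
theorem realifiedRigidAt (A B : (frame l hl).Dv) : (biCoricData l hl).RealifiedRigidAt A B :=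
  @realifiedRigidAt_ofKits_of_realifiedD _ _ _ _ (FKit.MonoLaws.toyTagged l hl) (FKit.isomFtoDBijective_toyTagged l hl)
    (FKit.isomFmtoDmSurjective_toyTagged l hl) (FKit.rlfOfIsStrip_toyTagged l hl) (timesMuSide l hl) (biCoricKit l hl) _ _ _
    (KitsToy.toyLines l hl) (KitsToy.toyCoeff l hl) (KitsToy.toyCoeff_pos l hl) (𝟭 _)
    (inducedFunctor (fun X : (MultKit.toy l hl).DMono =>
      (realifiedD (KitsToy.toyLines l hl) (KitsToy.toyCoeff l hl) (KitsToy.toyCoeff_pos l hl)).obj X))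
    (InducedCategory.faithful _)
    (realifiedDSmallForgetIso (KitsToy.toyLines l hl) (KitsToy.toyCoeff l hl) (KitsToy.toyCoeff_pos l hl) ≪≫
      (Functor.leftUnitor _).symm) A B

/-! ### 2. The tagged toy `ThetaMonoidKit`, `ThetaCoricKit`, `LatticeGlueKit` (shapes of abc-iut-L6-t3's) -/

/-- **IUTchII:Cor4.10(iv)** (kurims p.160) On the tagged toy `TimesMuSide` the composite `F^{⊩▶×μ} ↦ F^{⊢▶×μ} ↦ F^{⊢×μ}` is surjective on
isomorphisms (the `F^{⊢×μ}`-groupoid has exactly one isomorphism between any two objects) — abc-iut-w4-d028's hypothesis `h` DISCHARGED.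
[claim: Mochizuki2012, status: disputed] -/
theorem fglxmToFxm_mapIso_surjective (A B : (Literature.IUT.LogThetaLattice.KitsTaggedToy.timesMuSide l hl).Fglxm) :
    Function.Surjective (fun g : A ≅ B =>
      ((Literature.IUT.LogThetaLattice.KitsTaggedToy.timesMuSide l hl).FglxmToFvtxm ⋙
        (Literature.IUT.LogThetaLattice.KitsTaggedToy.timesMuSide l hl).FvtxmToFxm).mapIso g) := fun e =>
  ⟨(PrimeStripGroupoids.iso_nonempty_FrStrip A B).some, iso_eq_of_timesMuSide_Fxm l hl _ e⟩

/-- **IUTchIII:Prop2.1(ii)** (kurims p.58) The tagged toy `ThetaMonoidKit`: theta-monoid / realified categories `SingleObj Unit`,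
`F^⊩_{env}(†𝔇_>)` and `†𝔉^⊩_{env}` constant at the model `ℱ^⊩`-prime-strip, Kummer isomorphisms identities. [claim: Mochizuki2012, status: disputed] -/
def thetaMonoidKit : ThetaMonoidKit (timesMuSide l hl) where
  TM := SingleObj Unit
  RF := SingleObj Unit
  ΨenvD := (Functor.const _).obj (SingleObj.star Unit)
  ΨenvInfD := (Functor.const _).obj (SingleObj.star Unit)
  DglEnv := 𝟭 _
  ΨFenv := (Functor.const _).obj (SingleObj.star Unit)
  ΨFenvInf := (Functor.const _).obj (SingleObj.star Unit)
  CglEnv := (Functor.const _).obj (SingleObj.star Unit)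
  kummerΨ := KitsToy.toUnitIso _ _
  kummerΨInf := KitsToy.toUnitIso _ _
  kummerC := KitsToy.toUnitIso _ _
  FglEnvD := (Functor.const _).obj (frStrip l hl)
  FglEnvHT := (Functor.const _).obj (frStrip l hl)
  kummerFgl := NatIso.ofComponents (fun _ => Iso.refl _) (fun _ => rfl)
  fxmDeltaD := (Functor.const _).obj (SingleObj.star Unit)
  unitPortionD := KitsToy.toUnitIso _ _

/-- **IUTchIII:Cor2.3** (kurims p.72) The tagged toy `ThetaCoricKit`. [claim: Mochizuki2012, status: disputed] -/
def thetaCoricKit : ThetaCoricKit (timesMuSide l hl) where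
  dvDelta := (Functor.const _).obj (SingleObj.star Unit)
  fxmOfDv := 𝟭 _
  fxmOfDv_dv := Iso.refl _
  fglEnv := DHTRep.codFunctor ⋙ (thetaMonoidKit l hl).FglEnvD
  Rbad := SingleObj Unit
  rbad := (Functor.const _).obj (SingleObj.star Unit)
  iso_nonempty_Dv _ _ := ⟨Iso.refl _⟩

/-- **IUTchIII:Cor2.3(i)** (kurims p.72) The tagged toy `LatticeGlueKit`: the five kits with the eight identifications (identities / the
unique isomorphism into `SingleObj Unit`). [claim: Mochizuki2012, status: disputed] -/
def latticeGlueKit : LatticeGlueKit (FKit.rlfOfIsStrip_toyTagged l hl) (timesMuSide l hl) where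
  logKit := logKit l hl
  linkKit := thetaLinkKit l hl
  biCoricKit := biCoricKit l hl
  thetaMonoidKit := thetaMonoidKit l hl
  coricKit := thetaCoricKit l hl
  fglRoute_iso := KitsToy.toUnitIso _ _
  fxmDeltaHT_iso := KitsToy.toUnitIso _ _
  dvDelta_iso := KitsToy.toUnitIso _ _
  fxmOfDv_iso := KitsToy.toUnitIso _ _
  fxmOfDv_dv_compat := by ext; rfl
  fxmDeltaD_iso := KitsToy.toUnitIso _ _
  fglEnv_iso := Iso.refl _
  pilotEnv_iso := (Functor.rightUnitor _).symm

/-! ### 3. The glued data AND its lattice, parameter-free -/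

/-- **IUTchIII:Cor2.3(i)** (kurims p.72) **`LatticeGlue.ofKits` over the tagged toy kits**: the glued [IUTchIII] §1–§2 data over
`KitsTaggedToy.frame`, the [IUTchII]-side hypothesis discharged (`fglxmToFxm_mapIso_surjective`). [claim: Mochizuki2012, status: disputed] -/
def latticeGlue : LatticeGlue (frame l hl) :=
  LatticeGlue.ofKits (FKit.MonoLaws.toyTagged l hl) (FKit.isomFtoDBijective_toyTagged l hl)
    (FKit.isomFmtoDmSurjective_toyTagged l hl) (FKit.rlfOfIsStrip_toyTagged l hl) (timesMuSide l hl)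
    (fglxmToFxm_mapIso_surjective l hl) (latticeGlueKit l hl)

/-- **IUTchIII:Def1.4** (kurims p.45) **The log-theta-lattice over the glued data, PARAMETER-FREE**: abc-iut-L6-t3's `LatticeGlue.ofKitsDiagram`
applied to the injective family `p ↦ ^{p}ℋ𝒯` of `LatticeDiagramOfKitsTaggedToy.lean` — the pair `(latticeGlue, glueLatticeDiagram kind)`
is a kernel inhabitant of the input shape `(G : LatticeGlue S, Λ : LogThetaLatticeDiagram G.logData G.linkData)` (at universe `1`).
[claim: Mochizuki2012, status: disputed] -/
def glueLatticeDiagram (kind : LatticeKind) :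
    LogThetaLatticeDiagram (latticeGlue l hl).logData (latticeGlue l hl).linkData :=
  LatticeGlue.ofKitsDiagram _ _ _ _ _ _ _ kind (thetaPMEllHT l hl) (thetaPMEllHT_injective l hl)

/-- **IUTchIII:Cor2.3(i)** (kurims p.72) `LatticeGlue` over the tagged toy frame is NONEMPTY. [claim: Mochizuki2012, status: disputed] -/
theorem nonempty_latticeGlue :
    Nonempty (LatticeGlue (Literature.IUT.LogThetaLattice.KitsTaggedToy.frame l hl)) := ⟨latticeGlue l hl⟩

/-- **IUTchIII:Def1.4** (kurims p.45) The PAIR (glued §1–§2 data, log-theta-lattice over its log-data and link-data) is jointly inhabited over an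
assembled kit frame — for either kind. [claim: Mochizuki2012, status: disputed] -/
theorem nonempty_glue_and_lattice (kind : LatticeKind) :
    ∃ G : LatticeGlue (frame l hl), Nonempty (LogThetaLatticeDiagram G.logData G.linkData) ∧
      ∃ Λ : LogThetaLatticeDiagram G.logData G.linkData, Λ.kind = kind :=
  ⟨latticeGlue l hl, ⟨glueLatticeDiagram l hl kind⟩, glueLatticeDiagram l hl kind, rfl⟩

/-- **IUTchIII:Def1.4** (kurims p.45) The `(n, m)`-theater of the glued lattice is the tag-`(n, m)` copy `^{n,m}ℋ𝒯`. [claim: Mochizuki2012, status: disputed] -/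
theorem glueLatticeDiagram_HT (kind : LatticeKind) (p : ℤ × ℤ) :
    (glueLatticeDiagram l hl kind).HT p = AsSmall.up.obj (HTRep.of (thetaPMEllHT l hl p)) := rfl

/-- **IUTchIII:Thm1.5(i)** (kurims p.48) Thm 1.5 (i) (vertical coricity) for the glued lattice over the tagged toy frame. [claim: Mochizuki2012, status: disputed] -/
theorem glue_vertical_inducedDHT_full (kind : LatticeKind) (n m : ℤ) :
    ((glueLatticeDiagram l hl kind).vertical n m).inducedDHT = PolyIso.full _ _ := rfl

/-- **IUTchIII:Thm1.5(ii)** (kurims p.48) Thm 1.5 (ii) (horizontal coricity) for the glued lattice over the tagged toy frame. [claim: Mochizuki2012, status: disputed] -/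
theorem glue_horizontal_inducedFxm_full (kind : LatticeKind) (n m : ℤ) :
    (latticeGlue l hl).linkData.linkInducedFxm kind ((glueLatticeDiagram l hl kind).HT (n, m))
        ((glueLatticeDiagram l hl kind).HT (n + 1, m)) = PolyIso.full _ _ :=
  (glueLatticeDiagram l hl kind).horizontal_inducedFxm_full n m

/-- **IUTchIII:Thm1.5(iii)** (kurims p.49) Over the tagged toy glue, the bi-coric `F^{⊢×μ}`-prime-strip `F^{⊢×μ}_△(𝔇^⊢)` of a `𝒟^⊢`-prime-strip IS
that `𝒟^⊢`-prime-strip. [claim: Mochizuki2012, status: disputed] -/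
theorem latticeGlue_fxmOfDv_obj (D : (frame l hl).Dv) :
    (latticeGlue l hl).biCoric.fxmOfDv.obj D = AsSmall.up.obj (ULift.down D) := rfl

end KitsTaggedToy

end Literature.IUT.LogThetaLattice

end
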